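import Summits.KontsevichZagierPeriods.Zeta5Search.Barrier.ConeGammaCuspSymmetricJumps

/-!
# ζ(5) search — BARRIER: the CANONICAL FLIP PARTITION — the D-form without a supplied partition, and the period assembly

HONEST FRAMING (cell `pub-zeta5`): systematic search; no irrationality claim unless kernel-certified. MODEL objects
under Brown–Zudilin's (28)+(30) accounting ([BZ22] = arXiv:2210.03391; (28) observed, not proved); nothing here is a
statement about `ζ(5)`, any `γ` of record, the cone's supremum (C2 OPEN) or the VALUE of any jump at a named direction
(DATA of the cell); S-E stays CONJECTURED; records in print UNMOVED. Prover P2 g27, sequel (R) of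
`ConeGammaCuspSymmetricDForm` / `…Jumps` (item (a) of P2 g26's successor menu; INBOX 2026-08-27 l.9273 / l.9283).

`germ_symm_eq_sum_cells` / `germ_symm_eq_intComb` take a partition `−W = c_0 < ⋯ < c_n = W` through the member flip
points as a HYPOTHESIS. Here the partition is CONSTRUCTED (the sorted flip set, `Finset.orderEmbOfFin`), so the exact
form becomes a property of the junction alone, and the junctions of one period are assembled:
* `exists_chain_through` — order lemma: a finite set of reals inside `(lo, hi)` is threaded by a chain
  `lo = c_0 < ⋯ < c_n = hi` whose interior points lie in the set;
* **`exists_flip_partition`** — at every `b`, `δ` (all 28 forms of `a` positive): a partition `−W = c_0 < ⋯ < c_n = W`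
  through ALL 28 flip points `−φ_k(δ)/h_k(a)`, with interior points among them;
* **`germ_symm_exists_intComb`** — PARTITION-FREE EXACT FORM: for `b ∈ bkpts a T`, `δ`, and an admissible scale
  `0 < η` (`ηK < 1`, `ηK < wallDist`) ALONE, there are `n`, a chain `c` as above and integers `J_i` (`0 < i < n`) with
  `|J_i| ≤ #S` for every finset `S ⊇ {members flipping at c_i}`, `Σ_i J_i = 0`, and
  `germR(δ) + germL(δ) + germR(−δ) + germL(−δ) = Σ_{0<i<n} c_i · J_i` (the line step of the D-form is eliminated by
  `t = ηW`);
* **`cuspSlope_symm_eq_endGerms_add_intComb`** — PERIOD ASSEMBLY (hypotheses of g25's `cuspSlope_add_cuspSlope_neg_eq`):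
  `σ(δ) + σ(−δ) = E(δ) + Σ_{m<M−2} Σ_{0<i<n_m} c_{m,i} · J_{m,i}` with the canonical data of every interior junction
  `b_{m+1}`;
* **`intComb_le_neg_endGerms_of_isLocalMax`** — at a Regular OPEN-box local maximiser of the MODEL `γ` with `Q > 0`
  (g23's hypotheses): `Σ_m Σ_i c_{m,i}·J_{m,i} ≤ −E(δ)` and `0 ≤ E(δ)` in EVERY direction `δ` — the necessary
  condition at a cusp top in integer-combination form (the member flip times of the interior junctions, weighted by
  bounded zero-sum integers, must sum to `≤ −E(δ) ≤ 0`).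
NOT here (honest): the value of any `J` at a named direction (DATA: `HOME/pub-zeta5-p2/g27/alg/dform.py`); anything about
`γ` of record, C2, S-E, `ζ(5)`.
-/

noncomputable section

open Set MeasureTheory
open scoped Topology

namespace Summit.KontsevichZagierPeriods.Zeta5Search.Barrier.ConeGamma

/-! ### The canonical chain through a finite set of reals -/

/-- **Order lemma.** A finite set `V ⊂ (lo, hi)` of reals is threaded by a chain `lo = c_0 < c_1 < ⋯ < c_n = hi`
passing through every point of `V`, whose interior points `c_i` (`0 < i < n`) all lie in `V` (the sorted enumeration
of `V ∪ {lo, hi}`, `Finset.orderEmbOfFin`, extended by `hi` beyond `n`). -/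
theorem exists_chain_through (V : Finset ℝ) {lo hi : ℝ} (hlohi : lo < hi) (hlo : ∀ v ∈ V, lo < v)
    (hhi : ∀ v ∈ V, v < hi) :
    ∃ (n : ℕ) (c : ℕ → ℝ), c 0 = lo ∧ c n = hi ∧ (∀ j < n, c j < c (j + 1)) ∧
      (∀ v ∈ V, ∃ i ≤ n, c i = v) ∧ (∀ i, 0 < i → i < n → c i ∈ V) := by
  classical
  set V' : Finset ℝ := insert lo (insert hi V) with hV'
  have hloV : lo ∈ V' := by rw [hV']; exact Finset.mem_insert_self _ _
  have hhiV : hi ∈ V' := by rw [hV']; exact Finset.mem_insert_of_mem (Finset.mem_insert_self _ _)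
  have hne : V'.Nonempty := ⟨lo, hloV⟩
  set m := V'.card with hm
  have hm0 : 0 < m := Finset.card_pos.mpr hne
  set e := V'.orderEmbOfFin hm.symm with he
  have hlo' : ∀ v ∈ V', lo ≤ v := by
    intro v hv
    rw [hV', Finset.mem_insert, Finset.mem_insert] at hv
    rcases hv with rfl | rfl | hv
    · exact le_rfl
    · exact hlohi.le
    · exact (hlo v hv).le
  have hhi' : ∀ v ∈ V', v ≤ hi := by
    intro v hv
    rw [hV', Finset.mem_insert, Finset.mem_insert] at hv
    rcases hv with rfl | rfl | hv
    · exact hlohi.le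
    · exact le_rfl
    · exact (hhi v hv).le
  have hmin : V'.min' hne = lo := le_antisymm (Finset.min'_le _ _ hloV) (Finset.le_min' _ _ _ hlo')
  have hmax : V'.max' hne = hi := le_antisymm (Finset.max'_le _ _ _ hhi') (Finset.le_max' _ _ hhiV)
  refine ⟨m - 1, fun i => if h : i < m then e ⟨i, h⟩ else hi, ?_, ?_, ?_, ?_, ?_⟩
  · simp only [dif_pos hm0]
    rw [he, Finset.orderEmbOfFin_zero _ hm0, hmin]
  · simp only [dif_pos (Nat.sub_lt hm0 Nat.one_pos)]
    rw [he, Finset.orderEmbOfFin_last _ hm0, hmax]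
  · intro j hj
    have hj1 : j + 1 < m := by omega
    simp only [dif_pos (show j < m by omega), dif_pos hj1]
    exact e.strictMono (Fin.mk_lt_mk.mpr (Nat.lt_succ_self j))
  · intro v hv
    have hv' : v ∈ V' := by rw [hV']; exact Finset.mem_insert_of_mem (Finset.mem_insert_of_mem hv)
    have hr : v ∈ Set.range e := by rw [he, Finset.range_orderEmbOfFin]; exact hv'
    obtain ⟨i, hi⟩ := hr
    refine ⟨i.val, by omega, ?_⟩
    simp only [dif_pos i.isLt]
    exact hi
  · intro i hi0 hin
    have him : i < m := by omega
    simp only [dif_pos him]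
    have hmem : e ⟨i, him⟩ ∈ V' := by rw [he]; exact Finset.orderEmbOfFin_mem _ _ _
    have hne0 : e ⟨i, him⟩ ≠ lo := by
      rw [← hmin, ← Finset.orderEmbOfFin_zero hm.symm hm0, ← he]
      exact fun h => by
        have := e.injective h
        simp only [Fin.mk.injEq] at this
        omega
    have hne1 : e ⟨i, him⟩ ≠ hi := by
      rw [← hmax, ← Finset.orderEmbOfFin_last hm.symm hm0, ← he]
      exact fun h => by
        have := e.injective h
        simp only [Fin.mk.injEq] at this
        omega
    rw [hV', Finset.mem_insert, Finset.mem_insert] at hmem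
    rcases hmem with h | h | h
    · exact absurd h hne0
    · exact absurd h hne1
    · exact h

/-- **THE CANONICAL FLIP PARTITION.** For a direction with all 28 forms positive, every `b` and every displacement `δ`
there is a partition `−W = c_0 < c_1 < ⋯ < c_n = W` of `[−W(a,δ), W(a,δ)]` passing through all 28 flip points
`−φ_k(δ)/h_k(a)` (they lie inside `(−W, W)`, `abs_flip_lt_clusterWidth`) whose interior points are flip points. -/
theorem exists_flip_partition {a : Dir} (hpos : ∀ k, 0 < h28 a k) (δ : Fin 8 → ℝ) :
    ∃ (n : ℕ) (c : ℕ → ℝ), c 0 = -clusterWidth a δ ∧ c n = clusterWidth a δ ∧ (∀ j < n, c j < c (j + 1)) ∧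
      (∀ k : Fin 28, ∃ i ≤ n, c i = -(phiForm δ k / h28 a k)) ∧
      (∀ i, 0 < i → i < n → ∃ k : Fin 28, c i = -(phiForm δ k / h28 a k)) := by
  classical
  have hW := clusterWidth_pos hpos δ
  have hin : ∀ k : Fin 28, -clusterWidth a δ < -(phiForm δ k / h28 a k) ∧
      -(phiForm δ k / h28 a k) < clusterWidth a δ := fun k => by
    have h := abs_lt.mp (abs_flip_lt_clusterWidth hpos δ k)
    exact ⟨by linarith [h.2], by linarith [h.1]⟩
  obtain ⟨n, c, h0, hn, hmono, hmem, hint⟩ := exists_chain_through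
    (Finset.univ.image fun k : Fin 28 => -(phiForm δ k / h28 a k)) (by linarith : -clusterWidth a δ < clusterWidth a δ)
    (fun v hv => by obtain ⟨k, -, rfl⟩ := Finset.mem_image.mp hv; exact (hin k).1)
    (fun v hv => by obtain ⟨k, -, rfl⟩ := Finset.mem_image.mp hv; exact (hin k).2)
  refine ⟨n, c, h0, hn, hmono, fun k => hmem _ (Finset.mem_image.mpr ⟨k, Finset.mem_univ _, rfl⟩),
    fun i hi0 hi => ?_⟩
  obtain ⟨k, -, hk⟩ := Finset.mem_image.mp (hint i hi0 hi)
  exact ⟨k, hk.symm⟩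

/-! ### The partition-free exact form of one junction's vote -/

/-- **THE VOTE OF A JUNCTION IS AN INTEGER COMBINATION OF ITS FLIP TIMES — partition-free form.** Let all 28 forms of
`a` be positive, `b ∈ bkpts a T`, `δ` a displacement and `0 < η` with `ηK < 1`, `ηK < wallDist a T`. Then there are
`n`, a chain `−W = c_0 < ⋯ < c_n = W` through all 28 flip points (interior points flip points) and INTEGERS `J_i` with:
`|J_i| ≤ #S` for every `0 < i < n` and every finset `S` containing the members (`b·h_k ∈ ℤ`) whose flip point is `c_i`;
`Σ_{0<i<n} J_i = 0`; and `germR(δ) + germL(δ) + germR(−δ) + germL(−δ) = Σ_{0<i<n} c_i · J_i`. -/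
theorem germ_symm_exists_intComb {a : Dir} (hpos : ∀ k, 0 < h28 a k) {T b : ℝ} (hb : b ∈ bkpts a T)
    (δ : Fin 8 → ℝ) {η : ℝ} (hη : 0 < η) (h1 : η * clusterBound a δ < 1) (h2 : η * clusterBound a δ < wallDist a T) :
    ∃ (n : ℕ) (c : ℕ → ℝ) (J : ℕ → ℤ),
      c 0 = -clusterWidth a δ ∧ c n = clusterWidth a δ ∧ (∀ j < n, c j < c (j + 1)) ∧
      (∀ k : Fin 28, ∃ i ≤ n, c i = -(phiForm δ k / h28 a k)) ∧
      (∀ i, 0 < i → i < n → ∃ k : Fin 28, c i = -(phiForm δ k / h28 a k)) ∧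
      (∀ i, 0 < i → i < n → ∀ S : Finset (Fin 28),
        (∀ k, (∃ z : ℤ, b * h28 a k = z) → c i = -(phiForm δ k / h28 a k) → k ∈ S) → |J i| ≤ S.card) ∧
      ∑ i ∈ Finset.Ico 1 n, J i = 0 ∧
      germR a δ η b + germL a δ η b + germR a (-δ) η b + germL a (-δ) η b =
        ∑ i ∈ Finset.Ico 1 n, c i * (J i : ℝ) := by
  classical
  obtain ⟨n, c, hc0, hcn, hmono, hall, hint⟩ := exists_flip_partition hpos δ
  have hW := clusterWidth_pos hpos δ
  have hn : 0 < n := by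
    rcases Nat.eq_zero_or_pos n with h | h
    · rw [h] at hcn; linarith
    · exact h
  -- a line step below the walls: `t = ηW`
  have ht : 0 < η * clusterWidth a δ := mul_pos hη hW
  have htx : η * clusterWidth a δ * xMax a ≤ η * clusterBound a δ := by
    rw [mul_assoc]; exact mul_le_mul_of_nonneg_left (clusterWidth_mul_xMax_le_clusterBound a δ) hη.le
  -- the exact member flip sets
  set S₀ : ℕ → Finset (Fin 28) := fun i =>
    Finset.univ.filter fun k => (∃ z : ℤ, b * h28 a k = z) ∧ c i = -(phiForm δ k / h28 a k) with hS₀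
  obtain ⟨J, hJ, hsum, hR⟩ := germ_symm_eq_intComb hpos hb δ hη h1 h2 ht (htx.trans_lt h1) (htx.trans_lt h2) hn
    hc0 hcn hmono (fun k _ => hall k) (S := S₀)
    (fun i _ _ k hk hci => Finset.mem_filter.mpr ⟨Finset.mem_univ _, hk, hci⟩)
  refine ⟨n, c, J, hc0, hcn, hmono, hall, hint, fun i hi0 hin S hS => ?_, hsum, hR⟩
  refine (hJ i hi0 hin).trans ?_
  exact_mod_cast Finset.card_le_card fun k hk => by
    obtain ⟨-, hk1, hk2⟩ := Finset.mem_filter.mp hk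
    exact hS k hk1 hk2

/-! ### The period assembly -/

/-- **THE SYMMETRIC PART OF THE CUSP SLOPE OVER ONE PERIOD, IN INTEGER-COMBINATION FORM.** Under the hypotheses of
`cuspSlope_add_cuspSlope_neg_eq` (all 28 forms positive, a period `T`, ONE admissible scale `ρ` below every breakpoint
gap): there are, for every interior junction `b_{m+1}` (`m + 2 < #bkpts`), canonical data `n_m`, `c_{m,·}`, `J_{m,·}` as
in `germ_symm_exists_intComb`, such that
`σ(δ) + σ(−δ) = E(δ) + Σ_{m<M−2} Σ_{0<i<n_m} c_{m,i} · J_{m,i}`, `E(δ)` the four end germs. -/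
theorem cuspSlope_symm_eq_endGerms_add_intComb {a : Dir} (hpos : ∀ k, 0 < h28 a k) {T : ℝ} (hT : 0 < T)
    (hper : ∀ k : Fin 28, ∃ z : ℤ, T * h28 a k = z) (δ : Fin 8 → ℝ) {ρ : ℝ} (hρ : 0 < ρ)
    (h1 : ρ * clusterBound a δ < 1) (h2 : ρ * clusterBound a δ < wallDist a T)
    (hgap : ∀ m, m + 1 < (bkpts a T).card → 2 * ρ * clusterWidth a δ ≤ bkpt a T (m + 1) - bkpt a T m) :
    ∃ (n : ℕ → ℕ) (c : ℕ → ℕ → ℝ) (J : ℕ → ℕ → ℤ),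
      (∀ m, m + 2 < (bkpts a T).card →
        c m 0 = -clusterWidth a δ ∧ c m (n m) = clusterWidth a δ ∧ (∀ j < n m, c m j < c m (j + 1)) ∧
        (∀ k : Fin 28, ∃ i ≤ n m, c m i = -(phiForm δ k / h28 a k)) ∧
        (∀ i, 0 < i → i < n m → ∃ k : Fin 28, c m i = -(phiForm δ k / h28 a k)) ∧
        (∀ i, 0 < i → i < n m → ∀ S : Finset (Fin 28),
          (∀ k, (∃ z : ℤ, bkpt a T (m + 1) * h28 a k = z) → c m i = -(phiForm δ k / h28 a k) → k ∈ S) →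
            |J m i| ≤ S.card) ∧
        ∑ i ∈ Finset.Ico 1 (n m), J m i = 0) ∧
      cuspSlope a T δ + cuspSlope a T (-δ) =
        (germR a δ ρ 0 + germL a δ ρ T + (germR a (-δ) ρ 0 + germL a (-δ) ρ T)) +
          ∑ m ∈ Finset.range ((bkpts a T).card - 2), ∑ i ∈ Finset.Ico 1 (n m), c m i * (J m i : ℝ) := by
  classical
  have key : ∀ m : ℕ, ∃ (n : ℕ) (c : ℕ → ℝ) (J : ℕ → ℤ), m + 2 < (bkpts a T).card →
      (c 0 = -clusterWidth a δ ∧ c n = clusterWidth a δ ∧ (∀ j < n, c j < c (j + 1)) ∧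
        (∀ k : Fin 28, ∃ i ≤ n, c i = -(phiForm δ k / h28 a k)) ∧
        (∀ i, 0 < i → i < n → ∃ k : Fin 28, c i = -(phiForm δ k / h28 a k)) ∧
        (∀ i, 0 < i → i < n → ∀ S : Finset (Fin 28),
          (∀ k, (∃ z : ℤ, bkpt a T (m + 1) * h28 a k = z) → c i = -(phiForm δ k / h28 a k) → k ∈ S) →
            |J i| ≤ S.card) ∧
        ∑ i ∈ Finset.Ico 1 n, J i = 0) ∧
      germR a δ ρ (bkpt a T (m + 1)) + germL a δ ρ (bkpt a T (m + 1)) +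
          germR a (-δ) ρ (bkpt a T (m + 1)) + germL a (-δ) ρ (bkpt a T (m + 1)) =
        ∑ i ∈ Finset.Ico 1 n, c i * (J i : ℝ) := by
    intro m
    by_cases hm : m + 2 < (bkpts a T).card
    · obtain ⟨n, c, J, hc0, hcn, hmono, hall, hint, hJ, hsum, hR⟩ :=
        germ_symm_exists_intComb hpos (bkpt_mem (by omega : m + 1 < (bkpts a T).card)) δ hρ h1 h2
      exact ⟨n, c, J, fun _ => ⟨⟨hc0, hcn, hmono, hall, hint, hJ, hsum⟩, hR⟩⟩
    · exact ⟨0, fun _ => 0, fun _ => 0, fun h => absurd h hm⟩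
  choose n c J hspec using key
  refine ⟨n, c, J, fun m hm => (hspec m hm).1, ?_⟩
  rw [cuspSlope_add_cuspSlope_neg_eq hpos hT hper δ hρ h1 h2 hgap]
  congr 1
  exact Finset.sum_congr rfl fun m hm => (hspec m (by have := Finset.mem_range.mp hm; omega)).2

/-- **AT A LOCAL MAXIMISER OF THE MODEL `γ` THE INTEGER COMBINATION IS `≤ −E(δ) ≤ 0` IN EVERY DIRECTION.** At a
Regular OPEN-box direction with a period `T` and `Q = C₁ + δ₂₈ − Φ > 0` which is a local maximiser of `γ` (P2 g23's
hypotheses), for every displacement `δ` and admissible scale `ρ`: with the canonical data of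
`cuspSlope_symm_eq_endGerms_add_intComb`, `Σ_m Σ_{0<i<n_m} c_{m,i}·J_{m,i} ≤ −E(δ)` and `0 ≤ E(δ)` — the member flip
times of the interior junctions, weighted by bounded zero-sum integers, sum to `≤ −E(δ) ≤ 0`
(`cuspSlope_nonpos_of_isLocalMax` for `±δ`, `endGerms_nonneg`). A necessary condition, not a location. -/
theorem intComb_le_neg_endGerms_of_isLocalMax {a : Dir}
    (hopen : ∀ j : Fin 7, 0 < sParam a j.succ ∧ sParam a j.succ < sParam a 0)
    {T : ℝ} (hT : 0 < T) (hper : ∀ k : Fin 28, ∃ z : ℤ, T * h28 a k = z) (δ : Fin 8 → ℝ)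
    (hQ : 0 < C1 a + delta28 a - phi30 a) (hreg : Regular a) (hmax : IsLocalMax gamma a) {ρ : ℝ} (hρ : 0 < ρ)
    (h1 : ρ * clusterBound a δ < 1) (h2 : ρ * clusterBound a δ < wallDist a T)
    (hgap : ∀ m, m + 1 < (bkpts a T).card → 2 * ρ * clusterWidth a δ ≤ bkpt a T (m + 1) - bkpt a T m) :
    ∃ (n : ℕ → ℕ) (c : ℕ → ℕ → ℝ) (J : ℕ → ℕ → ℤ),
      (∀ m, m + 2 < (bkpts a T).card →
        c m 0 = -clusterWidth a δ ∧ c m (n m) = clusterWidth a δ ∧ (∀ j < n m, c m j < c m (j + 1)) ∧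
        (∀ k : Fin 28, ∃ i ≤ n m, c m i = -(phiForm δ k / h28 a k)) ∧
        (∀ i, 0 < i → i < n m → ∃ k : Fin 28, c m i = -(phiForm δ k / h28 a k)) ∧
        (∀ i, 0 < i → i < n m → ∀ S : Finset (Fin 28),
          (∀ k, (∃ z : ℤ, bkpt a T (m + 1) * h28 a k = z) → c m i = -(phiForm δ k / h28 a k) → k ∈ S) →
            |J m i| ≤ S.card) ∧
        ∑ i ∈ Finset.Ico 1 (n m), J m i = 0) ∧
      ∑ m ∈ Finset.range ((bkpts a T).card - 2), ∑ i ∈ Finset.Ico 1 (n m), c m i * (J m i : ℝ) ≤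
          -(germR a δ ρ 0 + germL a δ ρ T + (germR a (-δ) ρ 0 + germL a (-δ) ρ T)) ∧
      0 ≤ germR a δ ρ 0 + germL a δ ρ T + (germR a (-δ) ρ 0 + germL a (-δ) ρ T) := by
  have hpos := h28_pos_of_openBox hopen
  obtain ⟨n, c, J, hdata, heq⟩ := cuspSlope_symm_eq_endGerms_add_intComb hpos hT hper δ hρ h1 h2 hgap
  have s1 := cuspSlope_nonpos_of_isLocalMax hopen hT hper δ hQ hreg hmax
  have s2 := cuspSlope_nonpos_of_isLocalMax hopen hT hper (-δ) hQ hreg hmax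
  have hE := endGerms_nonneg hpos hper δ hρ.le h1
  exact ⟨n, c, J, hdata, by linarith, hE⟩

end Summit.KontsevichZagierPeriods.Zeta5Search.Barrier.ConeGamma

end
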